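import Summits.Ventures.PercRepro.S4MidKeyBaseNine

/-!
# PercRepro — THE MIDDLE KEY: `#U(p, q) ≤ Σ_k m[k, q]` AT LEVELS `7`, `8`, `9` (p1, gen 46; an S4 feeder — p9 owns SUBCLAIM-S4; no window claim here)

The `U`-side of the middle key in ONE row: the complement of a `U`-set is a rank-`q` set of `q … f(q)` points on the `e`-free core,
so `#U(p, q) ≤ Σ_{q ≤ k ≤ f(q)} m[k, q]` (`topCount_le_sum_uSets_<level>` composed with `ncard_uSets_le_rkSets`) — the certificates
then need no `UC` rows (`#uSets k ≤ m[k, q]`) and no `u`-atoms. `f(7) = 79`, `f(8) = 159`, `f(9) = 319`. Axioms: standard.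
-/

open scoped Matroid

namespace PercRepro

namespace S4Mid

open Set Finset S2LP S3Mid

variable {α : Type} {M : Matroid α} [M.Finite]

/-- **`#U(p, 7) ≤ Σ_{7 ≤ k ≤ 79} m[k, 7]`** on the `e`-free core. -/
theorem topCount_le_sum_rkSets_seven (p : ℕ) (h79 : ∀ X ⊆ M.E, M.eRk X ≤ ((7 : ℕ) : ℕ∞) → X.ncard ≤ 79)
    (hn79 : 79 ≤ M.E.ncard) :
    Matroid.topCount M p 7 ≤ ∑ i ∈ Finset.range 73, (S1.rkSets M (7 + i) 7).ncard :=
  (topCount_le_sum_uSets_seven p h79 hn79).trans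
    (Finset.sum_le_sum fun i _ => ncard_uSets_le_rkSets (M := M) p 7 (7 + i))

/-- **`#U(p, 8) ≤ Σ_{8 ≤ k ≤ 159} m[k, 8]`** on the `e`-free core. -/
theorem topCount_le_sum_rkSets_eight (p : ℕ) (h159 : ∀ X ⊆ M.E, M.eRk X ≤ ((8 : ℕ) : ℕ∞) → X.ncard ≤ 159)
    (hn159 : 159 ≤ M.E.ncard) :
    Matroid.topCount M p 8 ≤ ∑ i ∈ Finset.range 152, (S1.rkSets M (8 + i) 8).ncard :=
  (topCount_le_sum_uSets_eight p h159 hn159).trans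
    (Finset.sum_le_sum fun i _ => ncard_uSets_le_rkSets (M := M) p 8 (8 + i))

/-- **`#U(p, 9) ≤ Σ_{9 ≤ k ≤ 319} m[k, 9]`** on the `e`-free core. -/
theorem topCount_le_sum_rkSets_nine (p : ℕ) (h319 : ∀ X ⊆ M.E, M.eRk X ≤ ((9 : ℕ) : ℕ∞) → X.ncard ≤ 319)
    (hn319 : 319 ≤ M.E.ncard) :
    Matroid.topCount M p 9 ≤ ∑ i ∈ Finset.range 311, (S1.rkSets M (9 + i) 9).ncard :=
  (topCount_le_sum_uSets_nine p h319 hn319).trans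
    (Finset.sum_le_sum fun i _ => ncard_uSets_le_rkSets (M := M) p 9 (9 + i))

end S4Mid

end PercRepro
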